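import Summits.Schanuel.Schanuel.Theorems.ZilberEacExpExpBalance
import Summits.Schanuel.Schanuel.Theorems.ZilberEacMovingGraph
import HarnessLib

/-!
# Density over quadratic graph bases: every sign (the explosion regime closed)

Zilber's Exponential-Algebraic Closedness, case ladder (host summit Schanuel, cell `pub-schanuel`,
seat 2, gen 8).  For EVERY quadratic `p = αx² + βx + γ ∈ ℂ[x]` (`α ≠ 0`), EVERY `A ∈ ℂ[x]` and every
`F ∈ ℂ[u] ∖ {0}` the exponential points of the moving-target surface
`{x₁ = p(x₀), y₀ = A(x₀) + y₁ F(y₁)} ⊆ ℂ² × (ℂˣ)²` — the solutions of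
`e^{z} = A(z) + e^{p(z)} F(e^{p(z)})` — are ZARISKI DENSE (`unprojectedDense_movingGraph_quadratic`).
This removes the sign condition `Re(α (±i)²) = -Re α < 0` of `unprojectedDense_movingGraph` /
`Re α = 0` of the oscillatory theorem for quadratic bases: the EXPLOSION regime `Re α < 0`
(e.g. `e^{z} = z + e^{-z²}`: along every lattice ray `Re(-z²) → +∞`) is new.

Mechanism: the exp–exp balance (`exists_solution_expExp_quadratic`) produces solutions `z_k` with
`Re p(z_k) ≥ ρ √k` and `‖p(z_k)‖ ≤ C k`; along `k = m²` the coordinate `x₁ = p(z)` has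
`|Re x₁| / log(2 + ‖x₁‖) ≥ ρ m / (log(2 + C) + 2 log m) → ∞`, so THEOREM G
(`unprojectedDense_of_growth`) gives density.  With `deg A ≥ 1` the surface is moreover in
Mantova–Masser's case and free (`mmCase_movingGraph_of_two_le`): positive instances of the typed
density question in the explosion regime.

HONEST FRAMING: instances of Mantova–Masser's OPEN density question (existence is their Theorem 1.1);
cubic and higher bases in the explosion regime, `x₀`-dependent `F`, and `EC(3,2)` remain OPEN;
NOT Schanuel's conjecture; EAC ⇏ SC.
-/

noncomputable section

open Complex MvPolynomial Filter Topology
open Literature.NumberTheory.Transcendental Literature.ModelTheory.Zilber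

set_option linter.dupNamespace false

namespace Summit.Schanuel.Schanuel.Theorems

/-- **Density over every quadratic graph base.**  `α ≠ 0`, `β, γ ∈ ℂ`, ANY `A ∈ ℂ[x]`, `F ≠ 0`:
the exponential points of `{x₁ = αx₀² + βx₀ + γ, y₀ = A(x₀) + y₁ F(y₁)}` are Zariski dense.
(new) [cite: MantovaMasser2023, §1 Further remarks] -/
theorem unprojectedDense_movingGraph_quadratic {α : ℂ} (hα : α ≠ 0) (β γ : ℂ) (A : Polynomial ℂ)
    {F : Polynomial ℂ} (hF : F ≠ 0) :
    UnprojectedDense (movingGraphSurface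
      (Polynomial.C α * Polynomial.X ^ 2 + Polynomial.C β * Polynomial.X + Polynomial.C γ)
      A (F.toMvPolynomial 0)) := by
  classical
  set P : Polynomial ℂ :=
    Polynomial.C α * Polynomial.X ^ 2 + Polynomial.C β * Polynomial.X + Polynomial.C γ with hP
  have hPeval : ∀ x : ℂ, P.eval x = α * x ^ 2 + β * x + γ := by
    intro x; simp [hP]
  obtain ⟨ρ, C, hρ, hev⟩ := exists_solution_expExp_quadratic hα β γ A hF
  obtain ⟨k₀, hk₀⟩ := eventually_atTop.1 hev
  -- solutions at `k = max (m²) k₀`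
  have hsol : ∀ m : ℕ, ∃ z : ℂ,
      exp z = A.eval z + exp (P.eval z) * F.eval (exp (P.eval z)) ∧
      ρ * Real.sqrt ((max (m ^ 2) k₀ : ℕ) : ℝ) ≤ (P.eval z).re ∧
      ‖P.eval z‖ ≤ C * ((max (m ^ 2) k₀ : ℕ) : ℝ) := by
    intro m
    obtain ⟨z, h1, h2, h3⟩ := hk₀ (max (m ^ 2) k₀) (le_max_right _ _)
    exact ⟨z, by rw [hPeval]; exact h1, by rw [hPeval]; exact h2, by rw [hPeval]; exact h3⟩
  choose z hz using hsol
  -- the exponential points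
  set pt : ℕ → Fin 2 ⊕ Fin 2 → ℂ := fun m =>
    Sum.elim ![z m, P.eval (z m)] ![exp (z m), exp (P.eval (z m))] with hpt
  have hpS : ∀ m, pt m ∈ movingGraphSurface P A (F.toMvPolynomial 0) := by
    intro m
    rw [mem_movingGraphSurface_iff]
    constructor
    · rfl
    · simp only [hpt, Sum.elim_inl, Sum.elim_inr, Matrix.cons_val_zero, Matrix.cons_val_one,
        MvPolynomial.eval_toMvPolynomial]
      exact (hz m).1
  have hpΓ : ∀ m, pt m ∈ expGraph ℂ 2 := by
    intro m
    rw [mem_expGraph_iff]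
    intro i
    rw [Literature.ModelTheory.ExponentialFields.ExponentialRing.complex_exp_eq]
    fin_cases i <;> rfl
  refine unprojectedDense_of_growth (isIrreducibleClosed_polyFibredGraph _ _ _)
    (zariskiDim_polyFibredGraph _ _ _).le 1 hpS hpΓ ?_
  show Tendsto (fun m => |(P.eval (z m)).re| / Real.log (2 + ‖P.eval (z m)‖)) atTop atTop
  -- comparison with `ρ m / (log (2 + C') + 2 log m)`, `C' = max C 0`
  set C' : ℝ := max C 0 with hC'
  have hC'0 : 0 ≤ C' := le_max_right _ _
  have hApos : 0 < Real.log (2 + C') := Real.log_pos (by linarith)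
  have hlow := (tendsto_div_const_add_mul_log hApos (by norm_num : (0 : ℝ) ≤ 2)).const_mul_atTop hρ
  refine tendsto_atTop_mono' atTop ?_ hlow
  filter_upwards [eventually_ge_atTop (max k₀ 1)] with m hm
  have hm1 : 1 ≤ m := le_of_max_le_right hm
  have hmk : k₀ ≤ m ^ 2 := (le_of_max_le_left hm).trans (by nlinarith)
  have hmax : max (m ^ 2) k₀ = m ^ 2 := max_eq_left hmk
  obtain ⟨-, hre, hnorm⟩ := hz m
  rw [hmax] at hre hnorm
  push_cast at hre hnorm
  have hm1' : (1 : ℝ) ≤ m := by exact_mod_cast hm1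
  rw [Real.sqrt_sq (by positivity)] at hre
  have hnum : ρ * m ≤ |(P.eval (z m)).re| := hre.trans (le_abs_self _)
  have hnorm' : ‖P.eval (z m)‖ ≤ C' * (m : ℝ) ^ 2 :=
    hnorm.trans (mul_le_mul_of_nonneg_right (le_max_left _ _) (by positivity))
  have hden : Real.log (2 + ‖P.eval (z m)‖) ≤ Real.log (2 + C') + 2 * Real.log m := by
    calc Real.log (2 + ‖P.eval (z m)‖) ≤ Real.log ((2 + C') * (m : ℝ) ^ 2) := by
          refine Real.log_le_log (by positivity) ?_
          nlinarith
      _ = Real.log (2 + C') + 2 * Real.log m := by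
          rw [Real.log_mul (by positivity) (by positivity), Real.log_pow]; push_cast; ring
  have hdenpos : 0 < Real.log (2 + ‖P.eval (z m)‖) :=
    Real.log_pos (by linarith [norm_nonneg (P.eval (z m))])
  calc ρ * ((m : ℝ) / (Real.log (2 + C') + 2 * Real.log m))
      = (ρ * m) / (Real.log (2 + C') + 2 * Real.log m) := by ring
    _ ≤ |(P.eval (z m)).re| / (Real.log (2 + C') + 2 * Real.log m) :=
        div_le_div_of_nonneg_right hnum (by linarith [Real.log_natCast_nonneg m])
    _ ≤ |(P.eval (z m)).re| / Real.log (2 + ‖P.eval (z m)‖) :=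
        div_le_div_of_nonneg_left (abs_nonneg _) hdenpos hden

/-- **Positive instances of the FREE typed question in the explosion regime**: for a quadratic base
(`α ≠ 0`), `deg A ≥ 1` and `F ≠ 0` the surface is in Mantova–Masser's case, free, and its
exponential points are dense — whatever the sign of `Re α`. (new)
[cite: MantovaMasser2023, §1 Further remarks] -/
theorem unprojectedDensityQuestion_instance_movingGraph_quadratic {α : ℂ} (hα : α ≠ 0) (β γ : ℂ)
    {A : Polynomial ℂ} (hA : 0 < A.natDegree) {F : Polynomial ℂ} (hF : F ≠ 0) :
    MMCaseDimPiOneFree (movingGraphSurface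
        (Polynomial.C α * Polynomial.X ^ 2 + Polynomial.C β * Polynomial.X + Polynomial.C γ)
        A (F.toMvPolynomial 0)) ∧
      IsMulFree ℂ 2 (movingGraphSurface
        (Polynomial.C α * Polynomial.X ^ 2 + Polynomial.C β * Polynomial.X + Polynomial.C γ)
        A (F.toMvPolynomial 0) ∩ torusLocus ℂ 2) ∧
      UnprojectedDense (movingGraphSurface
        (Polynomial.C α * Polynomial.X ^ 2 + Polynomial.C β * Polynomial.X + Polynomial.C γ)
        A (F.toMvPolynomial 0)) := by
  have hdeg : (Polynomial.C α * Polynomial.X ^ 2 + Polynomial.C β * Polynomial.X +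
      Polynomial.C γ).natDegree = 2 := Polynomial.natDegree_quadratic hα
  obtain ⟨h1, h2⟩ := mmCase_movingGraph_of_two_le (by rw [hdeg]) hA (F.toMvPolynomial 0)
  exact ⟨h1, h2, unprojectedDense_movingGraph_quadratic hα β γ A hF⟩

/-- **Example (explosion regime)**: `e^{z} = z + e^{-z²}` — the exponential points of
`{x₁ = -x₀², y₀ = x₀ + y₁}` (`Re(-1 · i²) = 1 > 0`: `Re x₁ → +∞` along every lattice ray, so no
lattice-centre theorem applies) are Zariski dense, and the surface is in the case and free. (new) -/
theorem unprojectedDensityQuestion_instance_negParabola :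
    MMCaseDimPiOneFree (movingGraphSurface
        (Polynomial.C (-1) * Polynomial.X ^ 2 + Polynomial.C 0 * Polynomial.X + Polynomial.C 0)
        Polynomial.X ((1 : Polynomial ℂ).toMvPolynomial 0)) ∧
      IsMulFree ℂ 2 (movingGraphSurface
        (Polynomial.C (-1) * Polynomial.X ^ 2 + Polynomial.C 0 * Polynomial.X + Polynomial.C 0)
        Polynomial.X ((1 : Polynomial ℂ).toMvPolynomial 0) ∩ torusLocus ℂ 2) ∧
      UnprojectedDense (movingGraphSurface
        (Polynomial.C (-1) * Polynomial.X ^ 2 + Polynomial.C 0 * Polynomial.X + Polynomial.C 0)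
        Polynomial.X ((1 : Polynomial ℂ).toMvPolynomial 0)) :=
  unprojectedDensityQuestion_instance_movingGraph_quadratic (by norm_num) 0 0
    (by rw [Polynomial.natDegree_X]; exact one_pos) one_ne_zero

/-- … in particular `e^{z} = z + e^{-z²}` has infinitely many — indeed Zariski-densely many — complex
solutions; here is one. (new) -/
theorem exists_exp_eq_self_add_exp_neg_sq : ∃ z : ℂ, exp z = z + exp (-z ^ 2) := by
  obtain ⟨ρ, C, -, hev⟩ := exists_solution_expExp_quadratic (α := -1) (by norm_num) 0 0
    Polynomial.X one_ne_zero
  obtain ⟨-, z, hz, -, -⟩ := hev.exists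
  refine ⟨z, ?_⟩
  rw [hz]
  simp

end Summit.Schanuel.Schanuel.Theorems

end
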